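import Summits.AtomisticToContinuum.HydrodynamicLimit.Theses.OneFlightGossipEngine
import Summits.AtomisticToContinuum.HydrodynamicLimit.Theorems.EnergyCurrentTails.Negative.CubicTailExpMoment
import Literature.MathematicalPhysics.KineticTheory.HardSphereEulerProofs
import Literature.Barriers.AtomisticToContinuum.HighMomentumCutoffNarrow
import HarnessLib

/-!
# Docking (stub 3 of line `IdeatorThreeSketch` / card `loschmidt-tagging-exergy` for the crux
# `EnergyCurrentTails`, stmt-AtomisticToContinuum-9235)

Helper file of the line lead (prover-line-stmt-AtomisticToContinuum-9235-0) for the registered stub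
`stub_docking` of `Cruxes/EnergyCurrentTails/Lines/IdeatorThreeSketch.lean`.

The crux `OneFlightGossipEngine.EnergyCurrentTails` asks for `N`-uniform integrability of the
empirical cubic velocity tail `(N+1)⁻¹ ∑ᵢ 𝟙{M < |vᵢ(s)|}|vᵢ(s)|³` along the deterministic hard-sphere
flow started from local Gibbs data.  This file proves the BOOKKEEPING implication
`TAGGING → EXERGY → EnergyCurrentTails`:

* TAGGING (the Loschmidt tagging identity, stub 1): for the homogeneous Gibbs law
  `G = localGibbsLaw σ a 0 θr`, every density `F ≥ 0` and even one-particle observable `g ≥ 0`,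
  `∫ F(z) g(vᵢ(Φ_s z)) dG = ∫ g(vᵢ) F(flip(Φ_s z)) dG`;
* EXERGY (the exergy influence bound, stub 2): for each `t < T` constants `a, θr, β, C` with
  `βθr < 1`, `N₀`, and for `N ≥ N₀`, `s ∈ [0,t]` a measurable density `F` with
  `λ_N = G.withDensity F` and the tested Gaussian envelope
  `∫ g(vᵢ) F(flip Φ_s z) dG ≤ C ∫ g(vᵢ) e^{β|vᵢ|²/2} dG` for every measurable `g`.

Proof: write the crux integrand under `λ_N = F · G`, expand the empirical mean, apply TAGGING with
`g = 𝟙{M<|·|}|·|³` (even) and then EXERGY particle by particle; the right-hand side is the one-body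
tilted Gaussian tail `K(M) = ∫ 𝟙{M<|w|}|w|³ e^{β|w|²/2} N(0, θr)(dw)` (disintegration of the
homogeneous Gibbs law, `σ ≤ 1/2`), independent of `N` and `s`, and
`K(M) ≤ M⁻¹ ∫ |w|⁴ e^{β|w|²/2} N(0,θr)(dw) < ∞` because `βθr < 1`.

References: C. Cercignani, R. Illner, M. Pulvirenti, *The Mathematical Theory of Dilute Gases*
(1994) §4.2; H. Spohn, *Large Scale Dynamics of Interacting Particles* (1991) Part I §2.3.
-/

noncomputable section

open MeasureTheory Set Filter
open scoped ENNReal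

namespace Summit.AtomisticToContinuum.HydrodynamicLimit.Theorems.LoschmidtTagging

open Literature.MathematicalPhysics.KineticTheory Literature.Analysis.FluidPDE
open Summit.AtomisticToContinuum.HydrodynamicLimit.Theses.OneFlightGossipEngine
open Summit.AtomisticToContinuum.HydrodynamicLimit.Theorems.EnergyCurrentTailsNegative

/-- **One-body velocity marginal of the homogeneous Gibbs law.**  Under
`localGibbsLaw σ a 0 θ` (constant activity `a > 0`, zero drift, constant temperature `θ > 0`,
`σ ≤ 1/2`) the velocity of particle `i` is `N(0, θ I₃)`-distributed: one-body velocity expectations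
are `gaussMeasure 0 θ` expectations (disintegration `lintegral_localGibbsMeasure`). -/
theorem lintegral_vel_localGibbsLaw_const {σ : ℝ} (hσ : σ ≤ 1 / 2) {a θ : ℝ} (ha : 0 < a)
    (hθ : 0 < θ) (N : ℕ) (Φ : HardSphereFlow (Torus.geometry (Fin 3)) (hsDiameter σ N) (N + 1))
    (i : Fin (N + 1)) {H : V3 → ℝ≥0∞} (hH : Measurable H) :
    ∫⁻ z, H ((z i).2) ∂(localGibbsLaw σ (fun _ => a) (fun _ => 0) (fun _ => θ) N Φ) =
      ∫⁻ w, H w ∂(gaussMeasure (0 : V3) θ) := by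
  -- adapted from `lintegral_vel_localGibbsMeasure_const`
  -- (Cruxes/KineticCurrentsWindowLDUniform/Disproof.lean)
  rw [localGibbsLaw_eq]
  haveI := isProbabilityMeasure_localGibbsMeasure (a₀ := fun _ : T3 => a)
    (θ₀ := fun _ : T3 => θ) (u₀ := fun _ : T3 => (0 : V3)) continuous_const continuous_const
    continuous_const (fun _ => ha) (fun _ => hθ) hσ N
  have hG : Measurable fun z : Config (N + 1) (Fin 3) T3 => H ((z i).2) :=
    hH.comp (measurable_pi_apply i).snd
  rw [lintegral_localGibbsMeasure (a₀ := fun _ : T3 => a) (θ₀ := fun _ : T3 => θ)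
    (u₀ := fun _ : T3 => (0 : V3)) continuous_const continuous_const continuous_const
    (fun _ => ha.le) (fun _ => hθ) σ N hG]
  have hinner : ∀ x : Fin (N + 1) → T3,
      ∫⁻ v, H ((zipConfig (x, v) i).2) ∂velMeasure (fun _ => (0 : V3)) (fun _ => θ) x =
        ∫⁻ w, H w ∂gaussMeasure (0 : V3) θ := by
    intro x
    have hmp : MeasurePreserving (Function.eval i)
        (velMeasure (fun _ => (0 : V3)) (fun _ => θ) x) (gaussMeasure (0 : V3) θ) := by
      unfold velMeasure
      exact measurePreserving_eval _ i
    rw [← hmp.lintegral_comp hH]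
    rfl
  simp_rw [hinner]
  rw [lintegral_mul_const _ ?_, lintegral_posWeight_eq_one (a₀ := fun _ : T3 => a)
    (θ₀ := fun _ : T3 => θ) (u₀ := fun _ : T3 => (0 : V3)) continuous_const continuous_const
    continuous_const (fun _ => ha.le) (fun _ => hθ) σ N, one_mul]
  exact ((measurable_posWeight continuous_const _ _).const_mul _).ennreal_ofReal

/-- **The tilted quartic Gaussian moment is finite**: for `θ > 0` and `βθ < 1`,
`∫ |w|⁴ e^{β|w|²/2} N(0, θ I₃)(dw) < ∞` (write `N(0,θ)` as the Maxwellian density, bound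
`|w|⁴ ≤ (4/η²) e^{η|w|²}` with `β/2 + η < 1/(2θ)`, and use `lintegral_exp_quadratic_lt_top`). -/
theorem lintegral_norm_pow_four_mul_exp_lt_top {θ β : ℝ} (hθ : 0 < θ) (hβ : β * θ < 1) :
    ∫⁻ w, ENNReal.ofReal (‖w‖ ^ 4) * ENNReal.ofReal (Real.exp (β * ‖w‖ ^ 2 / 2))
      ∂(gaussMeasure (0 : V3) θ) < ∞ := by
  have hmeas : Measurable fun w : V3 =>
      ENNReal.ofReal (‖w‖ ^ 4) * ENNReal.ofReal (Real.exp (β * ‖w‖ ^ 2 / 2)) :=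
    (measurable_norm.pow_const 4).ennreal_ofReal.fun_mul
      (((measurable_norm.pow_const 2).const_mul β).div_const 2).exp.ennreal_ofReal
  rw [← withDensity_localMaxwellian_eq_gaussMeasure hθ (0 : V3),
    lintegral_withDensity_eq_lintegral_mul _
      (continuous_localMaxwellian 1 θ (0 : V3)).measurable.ennreal_ofReal hmeas]
  -- the rate gap
  have hβ2 : β / 2 < 1 / (2 * θ) := by
    rw [div_lt_div_iff₀ two_pos (by positivity)]
    nlinarith
  set η : ℝ := (1 / (2 * θ) - β / 2) / 2 with hη
  have hη0 : 0 < η := by rw [hη]; linarith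
  have hc : β / 2 + η < 1 / (2 * θ) := by rw [hη]; linarith
  -- the Maxwellian as a constant times a Gaussian
  set K : ℝ := (2 * Real.pi * θ) ^ (-(Module.finrank ℝ V3 : ℝ) / 2) with hK
  have hK0 : 0 < K := Real.rpow_pos_of_pos (by positivity) _
  have hMx : ∀ w : V3, localMaxwellian 1 θ 0 w = K * Real.exp (-‖w‖ ^ 2 / (2 * θ)) := by
    intro w
    simp [localMaxwellian, hK]
  -- the polynomial is dominated by a small Gaussian tilt
  have h4 : ∀ w : V3, ‖w‖ ^ 4 ≤ 4 / η ^ 2 * Real.exp (η * ‖w‖ ^ 2) := by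
    intro w
    have hx0 : 0 ≤ η * ‖w‖ ^ 2 / 2 := by positivity
    have hx1 : η * ‖w‖ ^ 2 / 2 ≤ Real.exp (η * ‖w‖ ^ 2 / 2) := by
      linarith [Real.add_one_le_exp (η * ‖w‖ ^ 2 / 2)]
    have hx2 : (η * ‖w‖ ^ 2 / 2) ^ 2 ≤ Real.exp (η * ‖w‖ ^ 2 / 2) ^ 2 :=
      pow_le_pow_left₀ hx0 hx1 2
    have hexp : Real.exp (η * ‖w‖ ^ 2 / 2) ^ 2 = Real.exp (η * ‖w‖ ^ 2) := by
      rw [sq, ← Real.exp_add]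
      congr 1
      ring
    rw [hexp] at hx2
    have hη2 : 0 < η ^ 2 := by positivity
    calc ‖w‖ ^ 4 = 4 / η ^ 2 * (η * ‖w‖ ^ 2 / 2) ^ 2 := by
          field_simp
          ring
      _ ≤ 4 / η ^ 2 * Real.exp (η * ‖w‖ ^ 2) := by gcongr
  have hpt : ∀ w : V3,
      (fun v => ENNReal.ofReal (localMaxwellian 1 θ (0 : V3) v)) w *
          (ENNReal.ofReal (‖w‖ ^ 4) * ENNReal.ofReal (Real.exp (β * ‖w‖ ^ 2 / 2))) ≤
        ENNReal.ofReal (K * (4 / η ^ 2)) *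
          ENNReal.ofReal (Real.exp ((β / 2 + η) * ‖w‖ ^ 2 - ‖w‖ ^ 2 / (2 * θ))) := by
    intro w
    simp only
    rw [← ENNReal.ofReal_mul (p := ‖w‖ ^ 4) (by positivity),
      ← ENNReal.ofReal_mul (p := localMaxwellian 1 θ (0 : V3) w)
        (localMaxwellian_nonneg zero_le_one hθ.le (0 : V3) w),
      ← ENNReal.ofReal_mul (p := K * (4 / η ^ 2)) (by positivity), hMx w]
    refine ENNReal.ofReal_le_ofReal ?_
    have hsplit : Real.exp ((β / 2 + η) * ‖w‖ ^ 2 - ‖w‖ ^ 2 / (2 * θ)) =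
        Real.exp (-‖w‖ ^ 2 / (2 * θ)) * (Real.exp (η * ‖w‖ ^ 2) *
          Real.exp (β * ‖w‖ ^ 2 / 2)) := by
      rw [← Real.exp_add, ← Real.exp_add]
      congr 1
      ring
    rw [hsplit]
    calc K * Real.exp (-‖w‖ ^ 2 / (2 * θ)) * (‖w‖ ^ 4 * Real.exp (β * ‖w‖ ^ 2 / 2))
        ≤ K * Real.exp (-‖w‖ ^ 2 / (2 * θ)) *
            (4 / η ^ 2 * Real.exp (η * ‖w‖ ^ 2) * Real.exp (β * ‖w‖ ^ 2 / 2)) := by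
          gcongr
          exact h4 w
      _ = K * (4 / η ^ 2) * (Real.exp (-‖w‖ ^ 2 / (2 * θ)) * (Real.exp (η * ‖w‖ ^ 2) *
            Real.exp (β * ‖w‖ ^ 2 / 2))) := by ring
  have hmeasI : Measurable fun w : V3 =>
      ENNReal.ofReal (Real.exp ((β / 2 + η) * ‖w‖ ^ 2 - ‖w‖ ^ 2 / (2 * θ))) :=
    (((measurable_norm.pow_const 2).const_mul (β / 2 + η)).sub
      ((measurable_norm.pow_const 2).div_const (2 * θ))).exp.ennreal_ofReal
  calc ∫⁻ w, (fun v => ENNReal.ofReal (localMaxwellian 1 θ (0 : V3) v)) w *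
          (ENNReal.ofReal (‖w‖ ^ 4) * ENNReal.ofReal (Real.exp (β * ‖w‖ ^ 2 / 2)))
      ≤ ∫⁻ w : V3, ENNReal.ofReal (K * (4 / η ^ 2)) *
          ENNReal.ofReal (Real.exp ((β / 2 + η) * ‖w‖ ^ 2 - ‖w‖ ^ 2 / (2 * θ))) :=
        lintegral_mono hpt
    _ = ENNReal.ofReal (K * (4 / η ^ 2)) *
          ∫⁻ w : V3, ENNReal.ofReal (Real.exp ((β / 2 + η) * ‖w‖ ^ 2 - ‖w‖ ^ 2 / (2 * θ))) :=
        lintegral_const_mul _ hmeasI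
    _ < ∞ := ENNReal.mul_lt_top ENNReal.ofReal_lt_top
        (Literature.Barriers.AtomisticToContinuum.lintegral_exp_quadratic_lt_top hc)

/-- Pointwise: above a positive cut-off `M` the tilted cubic tail is at most `M⁻¹` times the tilted
quartic, `𝟙{M<|w|}|w|³ e^{β|w|²/2} ≤ M⁻¹ |w|⁴ e^{β|w|²/2}`. -/
theorem ofReal_tail3_mul_exp_le {M : ℝ} (hM : 0 < M) (β : ℝ) (w : V3) :
    ENNReal.ofReal (tail3 M w) * ENNReal.ofReal (Real.exp (β * ‖w‖ ^ 2 / 2)) ≤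
      ENNReal.ofReal M⁻¹ *
        (ENNReal.ofReal (‖w‖ ^ 4) * ENNReal.ofReal (Real.exp (β * ‖w‖ ^ 2 / 2))) := by
  rw [← mul_assoc]
  refine mul_le_mul_left ?_ _
  rw [← ENNReal.ofReal_mul (inv_nonneg.2 hM.le)]
  refine ENNReal.ofReal_le_ofReal ?_
  by_cases hw : M < ‖w‖
  · rw [tail3_of_lt hw, le_inv_mul_iff₀ hM]
    calc M * ‖w‖ ^ 3 ≤ ‖w‖ * ‖w‖ ^ 3 := mul_le_mul_of_nonneg_right hw.le (by positivity)
      _ = ‖w‖ ^ 4 := by ring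
  · rw [tail3_of_le (not_lt.1 hw)]
    positivity

/-- **DOCKING** (registered stub `stub_docking` of line `IdeatorThreeSketch`, crux
stmt-AtomisticToContinuum-9235): the Loschmidt tagging identity and the exergy influence bound imply
`OneFlightGossipEngine.EnergyCurrentTails`.  With `λ_N = F · G` the crux integrand is
`(N+1)⁻¹ ∑ᵢ ∫ F(z) g(vᵢ(Φ_s z)) dG`, `g = 𝟙{M<|·|}|·|³` (even); TAGGING turns each term into the
tested form `∫ g(vᵢ) F(flip Φ_s z) dG`, EXERGY bounds it by `C ∫ g(vᵢ) e^{β|vᵢ|²/2} dG = C·K(M)`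
with `K(M)` the one-body tilted Gaussian cubic tail (independent of `N`, `s`), and
`C·K(M) ≤ C·M⁻¹·∫|w|⁴e^{β|w|²/2}dN(0,θr) ≤ ε` for `M = C·K₄/ε + 1`.  `σ₀ := min σ₀(EXERGY) (1/2)`
makes `G` a probability measure. -/
theorem stub_docking :
    (∀ (σ a θ : ℝ) (N : ℕ)
      (Φ : HardSphereFlow (Torus.geometry (Fin 3)) (hsDiameter σ N) (N + 1))
      (F : Config (N + 1) (Fin 3) T3 → ℝ≥0∞), Measurable F →
      ∀ (g : V3 → ℝ≥0∞), Measurable g → (∀ v, g (-v) = g v) →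
      ∀ (s : ℝ) (i : Fin (N + 1)),
        ∫⁻ z, F z * g ((Φ.flow s z i).2)
            ∂(localGibbsLaw σ (fun _ => a) (fun _ => 0) (fun _ => θ) N Φ)
          = ∫⁻ z, g ((z i).2) * F (flipVel (Φ.flow s z))
              ∂(localGibbsLaw σ (fun _ => a) (fun _ => 0) (fun _ => θ) N Φ)) →
    (∀ (a₀ θ₀ : T3 → ℝ) (u₀ : T3 → V3), Continuous a₀ → Continuous θ₀ → Continuous u₀ →
      (∀ x, 0 < a₀ x) → (∀ x, 0 < θ₀ x) →
      ∃ σ₀ : ℝ, 0 < σ₀ ∧ ∀ σ : ℝ, 0 < σ → σ < σ₀ →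
        ∀ (T : ℝ) (ρ θ : ℝ → T3 → ℝ) (u : ℝ → T3 → V3), IsHardSphereEulerSolution σ T ρ u θ →
          ∀ Φ : (N : ℕ) → HardSphereFlow (Torus.geometry (Fin 3)) (hsDiameter σ N) (N + 1),
            TendstoHydroFieldsAt (fun N => localGibbsLaw σ a₀ u₀ θ₀ N (Φ N)) Φ ρ u θ 0 →
              ∀ t ∈ Set.Ico 0 T, ∃ a θr β C : ℝ, 0 < a ∧ 0 < θr ∧ β * θr < 1 ∧ 0 ≤ C ∧
                ∃ N₀ : ℕ, ∀ N : ℕ, N₀ ≤ N → ∀ s ∈ Set.Icc 0 t,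
                  ∃ F : Config (N + 1) (Fin 3) T3 → ℝ≥0∞, Measurable F ∧
                    localGibbsLaw σ a₀ u₀ θ₀ N (Φ N)
                      = (localGibbsLaw σ (fun _ => a) (fun _ => 0) (fun _ => θr) N (Φ N)).withDensity F ∧
                    ∀ (i : Fin (N + 1)) (g : V3 → ℝ≥0∞), Measurable g →
                      ∫⁻ z, g ((z i).2) * F (flipVel ((Φ N).flow s z))
                          ∂(localGibbsLaw σ (fun _ => a) (fun _ => 0) (fun _ => θr) N (Φ N))
                        ≤ ENNReal.ofReal C *
                          ∫⁻ z, g ((z i).2) * ENNReal.ofReal (Real.exp (β * ‖(z i).2‖ ^ 2 / 2))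
                            ∂(localGibbsLaw σ (fun _ => a) (fun _ => 0) (fun _ => θr) N (Φ N))) →
    EnergyCurrentTails := by
  intro h1 h2 a₀ θ₀ u₀ ha hθ hu ha0 hθ0
  obtain ⟨σ₀, hσ₀, H⟩ := h2 a₀ θ₀ u₀ ha hθ hu ha0 hθ0
  refine ⟨min σ₀ (1 / 2), lt_min hσ₀ (by norm_num), ?_⟩
  intro σ hσ hσlt T ρ θ u hE Φ hT t ht ε hε
  have hσ₁ : σ < σ₀ := hσlt.trans_le (min_le_left _ _)
  have hσ2 : σ ≤ 1 / 2 := (hσlt.trans_le (min_le_right _ _)).le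
  obtain ⟨a, θr, β, C, ha', hθr, hβ, hC, N₀, hN⟩ := H σ hσ hσ₁ T ρ θ u hE Φ hT t ht
  -- the tilted quartic Gaussian moment (finite because `βθr < 1`)
  obtain ⟨K₄, hK₄⟩ : ∃ K : ℝ≥0∞, K = ∫⁻ w, ENNReal.ofReal (‖w‖ ^ 4) *
      ENNReal.ofReal (Real.exp (β * ‖w‖ ^ 2 / 2)) ∂(gaussMeasure (0 : V3) θr) := ⟨_, rfl⟩
  have hK₄top : K₄ ≠ ⊤ := by
    rw [hK₄]
    exact (lintegral_norm_pow_four_mul_exp_lt_top hθr hβ).ne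
  have hK₄r : 0 ≤ K₄.toReal := ENNReal.toReal_nonneg
  -- the cut-off
  obtain ⟨M, hMdef⟩ : ∃ M : ℝ, M = C * K₄.toReal / ε + 1 := ⟨_, rfl⟩
  have hM : 0 < M := by rw [hMdef]; positivity
  refine ⟨M, N₀, fun N hNN s hs => ?_⟩
  obtain ⟨F, hFm, hlaw, hbound⟩ := hN N hNN s hs
  -- the one-particle observable `g = 𝟙{M<|·|}|·|³` (even) and the Gaussian tilt
  have hgm : Measurable fun v : V3 => ENNReal.ofReal (tail3 M v) := (measurable_tail3 M).ennreal_ofReal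
  have hgeven : ∀ v : V3, ENNReal.ofReal (tail3 M (-v)) = ENNReal.ofReal (tail3 M v) := by
    intro v
    simp only [tail3, Set.indicator_apply, Set.mem_setOf_eq, norm_neg]
  have hEm : Measurable fun v : V3 => ENNReal.ofReal (Real.exp (β * ‖v‖ ^ 2 / 2)) :=
    (((measurable_norm.pow_const 2).const_mul β).div_const 2).exp.ennreal_ofReal
  -- Step 1: the crux integrand under `λ_N = F · G`
  have hH : Measurable fun z : Config (N + 1) (Fin 3) T3 =>
      ENNReal.ofReal (cubicTail N M ((Φ N).flow s z)) :=
    ((measurable_cubicTail N M).comp ((Φ N).measurable_flow s)).ennreal_ofReal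
  show ∫⁻ z, ENNReal.ofReal (cubicTail N M ((Φ N).flow s z)) ∂(localGibbsLaw σ a₀ u₀ θ₀ N (Φ N)) ≤
    ENNReal.ofReal ε
  rw [hlaw, lintegral_withDensity_eq_lintegral_mul _ hFm hH]
  -- Step 2: expand the empirical mean
  have hpt : ∀ z : Config (N + 1) (Fin 3) T3,
      (F * fun z => ENNReal.ofReal (cubicTail N M ((Φ N).flow s z))) z =
        ENNReal.ofReal (((N : ℝ) + 1)⁻¹) *
          ∑ i : Fin (N + 1), F z * ENNReal.ofReal (tail3 M (((Φ N).flow s z i).2)) := by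
    intro z
    simp only [Pi.mul_apply]
    unfold cubicTail
    rw [ENNReal.ofReal_mul (by positivity), ENNReal.ofReal_sum_of_nonneg fun i _ => tail3_nonneg M _,
      mul_left_comm, Finset.mul_sum]
  have hterm_meas : ∀ i : Fin (N + 1), Measurable fun z : Config (N + 1) (Fin 3) T3 =>
      F z * ENNReal.ofReal (tail3 M (((Φ N).flow s z i).2)) := fun i =>
    hFm.fun_mul (hgm.comp (measurable_snd.comp ((measurable_pi_apply i).comp ((Φ N).measurable_flow s))))
  have hsm : Measurable fun z : Config (N + 1) (Fin 3) T3 =>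
      ∑ i : Fin (N + 1), F z * ENNReal.ofReal (tail3 M (((Φ N).flow s z i).2)) :=
    Finset.measurable_sum _ fun i _ => hterm_meas i
  -- Step 3: each particle — tagging, exergy, one-body marginal, Chebyshev in `M`
  have hterm : ∀ i : Fin (N + 1),
      ∫⁻ z, F z * ENNReal.ofReal (tail3 M (((Φ N).flow s z i).2))
          ∂(localGibbsLaw σ (fun _ => a) (fun _ => 0) (fun _ => θr) N (Φ N)) ≤
        ENNReal.ofReal C * (ENNReal.ofReal M⁻¹ * K₄) := by
    intro i
    calc ∫⁻ z, F z * ENNReal.ofReal (tail3 M (((Φ N).flow s z i).2))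
          ∂(localGibbsLaw σ (fun _ => a) (fun _ => 0) (fun _ => θr) N (Φ N))
        = ∫⁻ z, ENNReal.ofReal (tail3 M ((z i).2)) * F (flipVel ((Φ N).flow s z))
            ∂(localGibbsLaw σ (fun _ => a) (fun _ => 0) (fun _ => θr) N (Φ N)) :=
          h1 σ a θr N (Φ N) F hFm (fun v => ENNReal.ofReal (tail3 M v)) hgm hgeven s i
      _ ≤ ENNReal.ofReal C * ∫⁻ z, ENNReal.ofReal (tail3 M ((z i).2)) *
            ENNReal.ofReal (Real.exp (β * ‖(z i).2‖ ^ 2 / 2))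
              ∂(localGibbsLaw σ (fun _ => a) (fun _ => 0) (fun _ => θr) N (Φ N)) :=
          hbound i (fun v => ENNReal.ofReal (tail3 M v)) hgm
      _ = ENNReal.ofReal C * ∫⁻ w, ENNReal.ofReal (tail3 M w) *
            ENNReal.ofReal (Real.exp (β * ‖w‖ ^ 2 / 2)) ∂(gaussMeasure (0 : V3) θr) :=
          congrArg (ENNReal.ofReal C * ·)
            (lintegral_vel_localGibbsLaw_const hσ2 ha' hθr N (Φ N) i (hgm.fun_mul hEm))
      _ ≤ ENNReal.ofReal C * (ENNReal.ofReal M⁻¹ * K₄) := by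
          refine mul_le_mul_right ?_ _
          rw [hK₄, ← lintegral_const_mul _ ((measurable_norm.pow_const 4).ennreal_ofReal.fun_mul hEm)]
          exact lintegral_mono fun w => ofReal_tail3_mul_exp_le hM β w
  -- Step 4: assemble
  have hN1 : ENNReal.ofReal (((N : ℝ) + 1)⁻¹) * ((N + 1 : ℕ) : ℝ≥0∞) = 1 := by
    rw [ENNReal.ofReal_inv_of_pos (by positivity)]
    have : ENNReal.ofReal ((N : ℝ) + 1) = ((N + 1 : ℕ) : ℝ≥0∞) := by
      rw [show ((N : ℝ) + 1) = ((N + 1 : ℕ) : ℝ) by push_cast; ring, ENNReal.ofReal_natCast]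
    rw [this]
    exact ENNReal.inv_mul_cancel (by simp) (ENNReal.natCast_ne_top _)
  calc ∫⁻ z, (F * fun z => ENNReal.ofReal (cubicTail N M ((Φ N).flow s z))) z
          ∂(localGibbsLaw σ (fun _ => a) (fun _ => 0) (fun _ => θr) N (Φ N))
      = ∫⁻ z, ENNReal.ofReal (((N : ℝ) + 1)⁻¹) *
          ∑ i : Fin (N + 1), F z * ENNReal.ofReal (tail3 M (((Φ N).flow s z i).2))
            ∂(localGibbsLaw σ (fun _ => a) (fun _ => 0) (fun _ => θr) N (Φ N)) :=
        lintegral_congr hpt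
    _ = ENNReal.ofReal (((N : ℝ) + 1)⁻¹) * ∑ i : Fin (N + 1),
          ∫⁻ z, F z * ENNReal.ofReal (tail3 M (((Φ N).flow s z i).2))
            ∂(localGibbsLaw σ (fun _ => a) (fun _ => 0) (fun _ => θr) N (Φ N)) := by
        rw [lintegral_const_mul _ hsm, lintegral_finsetSum _ fun i _ => hterm_meas i]
    _ ≤ ENNReal.ofReal (((N : ℝ) + 1)⁻¹) * ∑ _i : Fin (N + 1),
          ENNReal.ofReal C * (ENNReal.ofReal M⁻¹ * K₄) :=
        mul_le_mul_right (Finset.sum_le_sum fun i _ => hterm i) _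
    _ = ENNReal.ofReal C * (ENNReal.ofReal M⁻¹ * K₄) := by
        rw [Finset.sum_const, Finset.card_univ, Fintype.card_fin, nsmul_eq_mul, ← mul_assoc, hN1,
          one_mul]
    _ = ENNReal.ofReal (C * (M⁻¹ * K₄.toReal)) := by
        rw [ENNReal.ofReal_mul hC, ENNReal.ofReal_mul (inv_nonneg.2 hM.le),
          ENNReal.ofReal_toReal hK₄top]
    _ ≤ ENNReal.ofReal ε := by
        refine ENNReal.ofReal_le_ofReal ?_
        rw [mul_left_comm, inv_mul_le_iff₀ hM]
        have hMε : M * ε = C * K₄.toReal + ε := by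
          rw [hMdef]
          field_simp
        rw [hMε]
        linarith

end Summit.AtomisticToContinuum.HydrodynamicLimit.Theorems.LoschmidtTagging

end
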